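import Literature.AlgebraicGeometry.VanGeemen1994.WeilTypeHodgeGroupSUEndomorphismField
import Literature.AlgebraicGeometry.Milne1999.NotCMTypeOfSmallEndomorphismAlgebra
import Literature.AlgebraicGeometry.Motives.AbelianVarietySimpleOfEndAlgebraDomain
import HarnessLib

/-!
# `dim_ℚ End⁰(A) = 2` and `φ² = −d` ⟹ `End⁰(A) = ℚ(φ) ≅ ℚ(√−d)` is a field, `A` is simple and not of CM type
# (van Geemen 1994 6.9 ∕ Thm. 6.11; Mumford §19) — the `End⁰ = K` Weil rows' domain datum from the RANK alone

Family `hodge`, layer `Literature/AlgebraicGeometry/VanGeemen1994` (cell `pub-hodgeav-hg6`, req-37 (A) Q2b; eng-3 g3 — the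
discharge of the displayed domain hypothesis `¬ 𝒞 A` of the TABLE X row-9 census `TableX.WeilLieRows.census_weilType_endK`
(`SixfoldTableXCensusWeilEndFieldRowsAllMembers`) from its own binder `finrank ℚ End⁰(A) = 2`). The tree's
`WeilTypeHodgeGroupSUEndomorphismField` proves the same conclusions from van Geemen's `HasHodgeGroupSU`; here the ONLY input
is the rank `2` and `φ ≫ φ = −d` (`d ≥ 1`, `dim A ≥ 2`). UNCONDITIONAL; theorems only, no definition, no named fact, no `sorry`.
HONEST FRAMING of that cell: HC ∕ HC_AV ∕ HC_CM NOT proved — statements about `End⁰(A)`.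

* `exists_eq_smul_one_add_smul_of_finrank_endAlgebra_eq_two` — `End⁰(A) = ℚ·1 ⊕ ℚ·φ`.
* `endAlgebra_mul_comm_of_finrank_endAlgebra_eq_two` — `End⁰(A)` is commutative.
* `isField_endAlgebra_of_finrank_endAlgebra_eq_two` — `End⁰(A)` is a field (`(s + tφ)(s − tφ) = s² + d t²`).
* `isSimple_of_finrank_endAlgebra_eq_two`, `not_isOfCMType_of_finrank_endAlgebra_eq_two` — `A` is simple (the tree's
  `isSimple_of_isField_endAlgebra`) and, for `dim A ≥ 2`, not of CM type (`2 < 2 dim A`,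
  `not_isOfCMType_of_isSimple_of_finrank_endAlgebra_lt`).

## References
* [vanGeemen1994HodgeAV] B. van Geemen, LNM 1594 (1994), 6.9 and Thm. 6.11.
* [MumfordAV1970] D. Mumford, Abelian varieties (1970), §19 Thm. 3, Cor. 2 of Thm. 1 (p. 174).
* [Milne1999] J. S. Milne, Compositio Math. 117 (1999), §2 p. 54.
-/

noncomputable section

open CategoryTheory
open scoped TensorProduct
open Literature.AlgebraicGeometry.Motives
open Literature.AlgebraicGeometry.HodgeTheory
open Literature.AlgebraicGeometry.ComplexMultiplication

namespace Literature.AlgebraicGeometry.VanGeemen1994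

variable {A : AbelianVariety ℂ} {φ : A ⟶ A} {d : ℕ}

/-- `(1 ⊗ φ)² = -d` in `End⁰(A)` when `φ ≫ φ = -d` (`End(A) → End⁰(A)` is a ring map). [cite: MumfordAV1970, §19 Thm. 3] -/
private theorem of_mul_of_eq_neg' (hφ : φ ≫ φ = -(d • 𝟙 A)) :
    AbelianVariety.endAlgebra.of A φ * AbelianVariety.endAlgebra.of A φ =
      -(algebraMap ℚ A.endAlgebra (d : ℚ)) := by
  have h1 : AbelianVariety.endAlgebra.of A φ * AbelianVariety.endAlgebra.of A φ =
      AbelianVariety.endAlgebra.of A (φ ≫ φ) := by rw [← map_mul, End.mul_def]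
  have h2 : AbelianVariety.endAlgebra.of A (-(d • (1 : End A))) = -(algebraMap ℚ A.endAlgebra (d : ℚ)) := by
    rw [map_neg, map_nsmul, map_one, map_natCast, nsmul_eq_mul, mul_one]
  rw [h1, hφ]
  exact h2

/-- **`End⁰(A) = ℚ·1 ⊕ ℚ·φ` from the rank**: `finrank_ℚ End⁰(A) = 2`, `φ ≫ φ = −d`, `d ≥ 1`, `dim A > 0` ⟹ every element is
`s·1 + t·(1 ⊗ φ)` (`1, φ` are independent: `linearIndependent_one_of_comp_self_eq_neg`). [cite: vanGeemen1994HodgeAV, 6.9 and Thm. 6.11]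
[cite: MumfordAV1970, §19 Cor. 2 of Thm. 1 (p. 174)] -/
theorem exists_eq_smul_one_add_smul_of_finrank_endAlgebra_eq_two (hA0 : 0 < A.dim) (hd : 0 < d)
    (hφ : φ ≫ φ = -(d • 𝟙 A)) (hE2 : Module.finrank ℚ A.endAlgebra = 2) (x : A.endAlgebra) :
    ∃ s t : ℚ, x = s • (1 : A.endAlgebra) + t • AbelianVariety.endAlgebra.of A φ := by
  have hli := linearIndependent_one_of_comp_self_eq_neg (A := A) hA0 hd hφ
  -- (the two `AddCommMonoid` structures on the type synonym `End⁰(A)` are not bridged by instance search, cf.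
  -- `AbelianVarietyEndAlgebraInstances`; the vector-space lemma is fed its instances explicitly)
  have htop : Submodule.span ℚ (Set.range ![(1 : A.endAlgebra), AbelianVariety.endAlgebra.of A φ]) = ⊤ :=
    @LinearIndependent.span_eq_top_of_card_eq_finrank' ℚ A.endAlgebra _ Ring.toAddCommGroup Algebra.toModule (Fin 2) _
      (AbelianVariety.endAlgebra.instModuleFinite A) _ hli ((Fintype.card_fin 2).trans hE2.symm)
  have hx := Submodule.eq_top_iff'.1 htop x
  rw [Matrix.range_cons, Matrix.range_cons, Matrix.range_empty, Set.union_empty, Set.singleton_union] at hx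
  obtain ⟨s, t, hst⟩ := Submodule.mem_span_pair.1 hx
  exact ⟨s, t, hst.symm⟩

/-- **`End⁰(A)` is commutative** when `finrank_ℚ End⁰(A) = 2` and `φ ≫ φ = −d`: everything is `s + tφ`.
[cite: vanGeemen1994HodgeAV, Thm. 6.11] [cite: MumfordAV1970, §19 Cor. 2 of Thm. 1 (p. 174)] -/
theorem endAlgebra_mul_comm_of_finrank_endAlgebra_eq_two (hA0 : 0 < A.dim) (hd : 0 < d) (hφ : φ ≫ φ = -(d • 𝟙 A))
    (hE2 : Module.finrank ℚ A.endAlgebra = 2) (x y : A.endAlgebra) : x * y = y * x := by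
  have hey : AbelianVariety.endAlgebra.of A φ * y = y * AbelianVariety.endAlgebra.of A φ := by
    obtain ⟨s', t', rfl⟩ := exists_eq_smul_one_add_smul_of_finrank_endAlgebra_eq_two hA0 hd hφ hE2 y
    simp only [mul_add, add_mul, mul_smul_comm, smul_mul_assoc, mul_one, one_mul]
  obtain ⟨s, t, rfl⟩ := exists_eq_smul_one_add_smul_of_finrank_endAlgebra_eq_two hA0 hd hφ hE2 x
  simp only [mul_add, add_mul, mul_smul_comm, smul_mul_assoc, mul_one, one_mul, hey]

/-- **`End⁰(A)` IS A FIELD** (`= ℚ(φ) ≅ ℚ(√-d)`) when `finrank_ℚ End⁰(A) = 2`, `φ ≫ φ = −d`, `d ≥ 1`, `dim A > 0`: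
commutative, and `(s + tφ)(s − tφ) = s² + d t²` is invertible for `(s, t) ≠ 0`. [cite: vanGeemen1994HodgeAV, 6.9 and Thm. 6.11]
[cite: MumfordAV1970, §19 Cor. 2 of Thm. 1 (p. 174)] -/
theorem isField_endAlgebra_of_finrank_endAlgebra_eq_two (hA0 : 0 < A.dim) (hd : 0 < d) (hφ : φ ≫ φ = -(d • 𝟙 A))
    (hE2 : Module.finrank ℚ A.endAlgebra = 2) : IsField A.endAlgebra := by
  haveI := nontrivial_endAlgebra_of_dim_pos (B := A) hA0
  have hcomm := endAlgebra_mul_comm_of_finrank_endAlgebra_eq_two hA0 hd hφ hE2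
  obtain ⟨c, hc⟩ : ∃ c : ℚ →+* A.endAlgebra, c = algebraMap ℚ A.endAlgebra := ⟨_, rfl⟩
  refine ⟨⟨0, 1, zero_ne_one⟩, hcomm, fun {x} hx => ?_⟩
  obtain ⟨s, t, rfl⟩ := exists_eq_smul_one_add_smul_of_finrank_endAlgebra_eq_two hA0 hd hφ hE2 x
  obtain ⟨y, hy⟩ : ∃ y : A.endAlgebra, y = AbelianVariety.endAlgebra.of A φ := ⟨_, rfl⟩
  have hsq : y * y = -(c d) := by rw [hy, hc]; exact of_mul_of_eq_neg' hφ
  rw [← hy] at hx ⊢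
  -- `N = s² + d t² ≠ 0`
  have hN : s * s + (d : ℚ) * (t * t) ≠ 0 := by
    intro hN
    have hs : s = 0 := by nlinarith [mul_self_nonneg s, mul_self_nonneg t, (Nat.cast_pos.2 hd : (0 : ℚ) < d)]
    subst hs
    have ht : t = 0 := by
      have : (d : ℚ) * (t * t) = 0 := by simpa using hN
      exact mul_self_eq_zero.1 ((mul_eq_zero.1 this).resolve_left (Nat.cast_pos.2 hd).ne')
    subst ht
    exact hx (by rw [zero_smul, zero_smul, add_zero])
  refine ⟨(c s - c t * y) * c (s * s + (d : ℚ) * (t * t))⁻¹, ?_⟩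
  letI : CommRing A.endAlgebra := { toRing := inferInstance, mul_comm := hcomm }
  have hprod : (c s + c t * y) * (c s - c t * y) = c (s * s + (d : ℚ) * (t * t)) := by
    have h1 : (c s + c t * y) * (c s - c t * y) = c s * c s - c t * c t * (y * y) := by ring
    rw [h1, hsq]
    simp only [map_add, map_mul]
    ring
  rw [Algebra.smul_def, Algebra.smul_def, ← hc, mul_one, ← mul_assoc, hprod, ← map_mul, mul_inv_cancel₀ hN, map_one]

/-- **`A` IS SIMPLE** when `finrank_ℚ End⁰(A) = 2` and `φ ≫ φ = −d` (`End⁰(A)` is a field; the tree's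
`isSimple_of_isField_endAlgebra`). [cite: vanGeemen1994HodgeAV, 6.9] [cite: MumfordAV1970, §19 Cor. 2 of Thm. 1 (p. 174)] -/
theorem isSimple_of_finrank_endAlgebra_eq_two (hA0 : 0 < A.dim) (hd : 0 < d) (hφ : φ ≫ φ = -(d • 𝟙 A))
    (hE2 : Module.finrank ℚ A.endAlgebra = 2) : AbelianVariety.IsSimple A :=
  AbelianVariety.isSimple_of_isField_endAlgebra (isField_endAlgebra_of_finrank_endAlgebra_eq_two hA0 hd hφ hE2)

/-- **`A` IS NOT OF CM TYPE** when `finrank_ℚ End⁰(A) = 2`, `φ ≫ φ = −d` and `dim A ≥ 2` (`A` simple with `2 < 2 dim A`).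
[cite: vanGeemen1994HodgeAV, Thm. 6.11] [cite: Milne1999, §2 p. 54] -/
theorem not_isOfCMType_of_finrank_endAlgebra_eq_two (hA2 : 2 ≤ A.dim) (hd : 0 < d) (hφ : φ ≫ φ = -(d • 𝟙 A))
    (hE2 : Module.finrank ℚ A.endAlgebra = 2) : ¬ Milne1999.IsOfCMType A :=
  Milne1999.not_isOfCMType_of_isSimple_of_finrank_endAlgebra_lt
    (isSimple_of_finrank_endAlgebra_eq_two (by omega) hd hφ hE2) (by omega) (by rw [hE2]; omega)

end Literature.AlgebraicGeometry.VanGeemen1994
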